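import Literature.NumberTheory.Rogawski1990.RankOneUnstableWildEigenLabels                  -- ★ p844311 (A-p03 (g26)): `eigen_labels_of_descent_frame`, `deep_bounds_of_valued_sub_lt`, `valued_mul_lt_one_of_conj`; brings ★ p844273 FILE A
import Literature.NumberTheory.Rogawski1990.RankOneUnstableDeltaSymbolTorusCoordinatesDepth    -- ★ p844075 (B-p12 (g30)): `valued_toPlace_bcoord_eq` (`|ι bc| = |a−c|·|2|∕|η|`)
import HarnessLib

/-!
# [LabesseLanglands1979 §2 (2.1)–(2.2); Labesse2024 Prop. 0.0.11, Th. 0.0.12] road «W′» = «R1LL-WILD», sub-socket (B6-O) FILE B — PLACE-LEVEL CORE of the TORUS WRAPPER: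
# the window coordinate `βF` of the descended torus element against the difference coordinate `bc` (depth and sign dictionaries, both label cases)

Topic `NumberTheory/Rogawski1990`; namespace `Literature.NumberTheory.Rogawski1990`.  THEOREMS ONLY (no definition, no instance, no notation, no named fact, no `sorry`).
Cell `pub/hodgecm-mathlib` (D-0151), crux H413 = `stmt-HodgeConjecture-24833`, line «N6nsGerm», wild residue `stub_N6nsR1ramWild`; (W′-B6) fold ★ p844308 + ★ p844316
(F0P3-p01 (g14)) binders `(k₀ c₀ hoT hκT)` ∕ `hnn`; (B6-O) FILE A ★ p844273 + labels ★ p844311 (A-p03 (g26)); FILE B = B-p12 (g30) (orphan adopted 12:42Z, census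
`F0/P3a/B-p12/g30/CENSUS-B6O-FILEB-TorusWrapper.B-p12g30.md`).  HONEST LABEL: HC_CM is proved only modulo the printed citations (the 2 remaining named inputs hLiu418, h413)
until rung 0 closes; this file is `2 × 2` algebra and valuation bookkeeping and asserts nothing printed.

THE MATHEMATICS.  At a ramified non-split `w ∣ v`, a torus element read at `w` is a matrix `X` with `X·Q = Q·diag(x₀, x₁)` (frame, norm-one `xᵢ`) and DESCENT
`diag(1,α)·X·diag(1,α)⁻¹ = s • ι(a + b·M_τ)`, `M_τ = !![0, v₀; 1, u₀]` (★ A-p13 p844241).  The (B6-V) WINDOW COORDINATE is `βF := b∕a`, read by B-p14 (g33) as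
`ι βF = α·X₁₀∕X₀₀` (§1 `toPlace_div_eq_windowCoord`).  With the frame column on the eigenline `(−σ_w τ : 1)` (label case; the other case is this one at `τ ↦ σ_w τ`),
`x₀ = s ι a·(1 + ι βF·τ)`, `x₁ = s ι a·(1 + ι βF·σ_w τ)` (★ `eigen_labels_of_descent_frame`), and on the deep locus (★ `deep_bounds_of_valued_sub_lt`) FILE A gives
(DEPTH) `|ι bc|_w = |ι βF|_w·|ι(2c′)|_w` and (SIGN) `(bc·2c′, θ)_v = (βF, θ)_v` for `ι c′ = (τ − σ_w τ)∕η` — HEAD `depth_and_sign_of_descent_frame`.  §3 packages the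
fold's currency: `|ι βF|_w = exp(−2o)` from `|βF|_v = exp(−o)` (`e = 2`), the constant `|ι(2c′)|_w = exp(−2k₁)` with `k₁ := −log|2c′|_v`, hence `hoT`'s `exp(−(2o + 2k₁))`;
a NORM power in the sign argument drops (`(βF·n^k, θ)_v = (βF, θ)_v`, `(n, θ)_v = 1`); `hnn` from `|ι bc| ≤ 1`.
NOT here: the torus-level wrapper (FILE B proper, keyed to B-p14 (g33)'s (B6-V) export literal and the HEAD's frame `hQ`), the case split along the torus.

## References
* [LabesseLanglands1979] J.-P. Labesse, R. P. Langlands, *L-indistinguishability for SL(2)*, Canad. J. Math. 31 (1979): §2 (2.1)–(2.2) pp. 8–9.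
* [Labesse2024StabilisationGermesSL2] J.-P. Labesse, *Stabilisation des germes de SL(2)* (arXiv:2411.14820, 2024): Prop. 0.0.10–0.0.11, Th. 0.0.12 pp. 7–8.
* [Rogawski1990] J. D. Rogawski, *Automorphic Representations of Unitary Groups in Three Variables*, Ann. of Math. Stud. 123 (1990): §3.6 pp. 31–32, §4.9 Lemma 4.9.3 p. 56.
* [Omeara1963] O. T. O'Meara, *Introduction to Quadratic Forms* (1963): §63B (the local Hilbert symbol, bimultiplicativity).
-/

set_option autoImplicit false

noncomputable section

open NumberField IsDedekindDomain Matrix ValuativeRel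
open scoped Matrix

namespace Literature.NumberTheory.Rogawski1990

open Literature.NumberTheory.Automorphic Literature.NumberTheory.Automorphic.UnitaryGroup Literature.NumberTheory.GaloisRepresentations
open Literature.NumberTheory.QuadraticForms Literature.NumberTheory.NumberFields

/-! ## §1 The window coordinate of a descended matrix -/

section Window

variable {F E : Type*} [Field F] [Field E] (ι : F →+* E)

/-- **THE WINDOW COORDINATE IS `b∕a`**: if `diag(1,α)·X·diag(1,α⁻¹) = s • ι(!![a, b v₀; b, a + b u₀])` with `α ≠ 0` then `X₀₀ = s·ι a` and `α·X₁₀ = s·ι b`; hence for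
`s ≠ 0`: `α·X₁₀∕X₀₀ = ι(b∕a)`. [cite: LabesseLanglands1979, §2 (2.1)] [cite: Labesse2024StabilisationGermesSL2, Prop. 0.0.11] -/
theorem descent_entries {α s : E} {a b u₀ v₀ : F} {X : Matrix (Fin 2) (Fin 2) E}
    (hG : Matrix.diagonal ![1, α] * X * Matrix.diagonal ![1, α⁻¹] = s • (!![a, b * v₀; b, a + b * u₀]).map ι) :
    X 0 0 = s * ι a ∧ α * X 1 0 = s * ι b := by
  have h00 := congr_fun (congr_fun hG 0) 0
  have h10 := congr_fun (congr_fun hG 1) 0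
  simp [Matrix.mul_apply, Matrix.diagonal] at h00 h10
  exact ⟨h00, h10⟩

/-- `α·X₁₀∕X₀₀ = ι(b∕a)` for the descended matrix (`s ≠ 0`; junk-consistent at `a = 0`) — B-p14 (g33)'s reading `ι βF = α X₁₀∕X₀₀` of the window coordinate IS `b∕a`.
[cite: LabesseLanglands1979, §2 (2.1)] -/
theorem toPlace_div_eq_windowCoord {α s : E} {a b u₀ v₀ : F} {X : Matrix (Fin 2) (Fin 2) E} (hs : s ≠ 0)
    (hG : Matrix.diagonal ![1, α] * X * Matrix.diagonal ![1, α⁻¹] = s • (!![a, b * v₀; b, a + b * u₀]).map ι) :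
    α * X 1 0 / X 0 0 = ι (b / a) := by
  obtain ⟨h00, h10⟩ := descent_entries ι hG
  rw [h10, h00, map_div₀, mul_div_mul_left _ _ hs]

/-- If moreover `ι βF = α X₁₀∕X₀₀` then `βF = b∕a` (`ι` injective). [cite: LabesseLanglands1979, §2 (2.1)] -/
theorem windowCoord_eq_div {α s : E} {a b u₀ v₀ βF : F} {X : Matrix (Fin 2) (Fin 2) E} (hs : s ≠ 0)
    (hG : Matrix.diagonal ![1, α] * X * Matrix.diagonal ![1, α⁻¹] = s • (!![a, b * v₀; b, a + b * u₀]).map ι)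
    (hβF : ι βF = α * X 1 0 / X 0 0) : βF = b / a :=
  ι.injective (by rw [hβF, toPlace_div_eq_windowCoord ι hs hG])

end Window

/-! ## §2 Place level: depth and sign of `bc` against the window coordinate, one label case -/

section Place

variable (L : Type) [Field L] [NumberField L] [IsCMField L] (v : HeightOneSpectrum (𝓞 ↥(maximalRealSubfield L)))
  (w : PlacesOver L v) (hw : IsCMField.complexConj L • w.1 = w.1)

include hw in
/-- **HEAD (place level) — DEPTH AND SIGN OF THE DIFFERENCE COORDINATE AGAINST THE WINDOW COORDINATE.**  Data at the place: an Eisenstein-type `τ ∈ L_w` with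
`τ + σ_w τ = ι u₀`, `τ·σ_w τ = −ι v₀`, `τ ≠ σ_w τ`; a skew `η ≠ 0`; `α ≠ 0`; a matrix `X` framed by `Q` (`X·Q = Q·diag(x₀,x₁)`, `det Q` a unit) with eigenvalues `x₀ ≠ x₁`,
`|x₁| = 1`, and DESCENT `diag(1,α)·X·diag(1,α⁻¹) = s • ι(a + b M_τ)`; the frame column in the LABEL CASE `(diag(1,α)Q)₀₀ = −σ_w τ·(diag(1,α)Q)₁₀ ≠ 0`;
DEEPNESS `|x₀ − x₁|·|σ_w τ| < |τ − σ_w τ|` and `|x₀ − x₁|·|ι u₀| < |8|·|τ − σ_w τ|`; the difference coordinate `ι bc = (x₀∕x₁ − x₁∕x₀)∕η`; the window coordinate `ι βF = α X₁₀∕X₀₀`;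
and `ι c′ = (τ − σ_w τ)∕η`.  THEN: `βF = b∕a ≠ 0`, **`|ι bc|_w = |ι βF|_w · |ι(2c′)|_w`** and **`(bc·(2c′), θ)_v = (βF, θ)_v`**.  (The other label case is this statement at
`τ ↦ σ_w τ`, with `c′ ↦ −c′`.)  Chain: ★ `eigen_labels_of_descent_frame` ∘ ★ `deep_bounds_of_valued_sub_lt` ∘ ★ `valued_toPlace_bcoord_eq_eisenstein` ∕ ★
`hilbertSymbol_bcoord_mul_eq_eisenstein`. [cite: LabesseLanglands1979, §2 (2.1)–(2.2)] [cite: Labesse2024StabilisationGermesSL2, Prop. 0.0.11, Th. 0.0.12] [cite: Omeara1963, §63B] -/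
theorem depth_and_sign_of_descent_frame {τ η α : w.1.adicCompletion L} {u₀ v₀ : v.adicCompletion ↥(maximalRealSubfield L)}
    (hsum : τ + galAdicCompletionMap (L := L) (IsCMField.complexConj L) hw τ = toPlace v w u₀)
    (hprod : τ * galAdicCompletionMap (L := L) (IsCMField.complexConj L) hw τ = -toPlace v w v₀)
    (hτne : τ ≠ galAdicCompletionMap (L := L) (IsCMField.complexConj L) hw τ)
    (hη0 : η ≠ 0) (hα0 : α ≠ 0)
    {X Q : Matrix (Fin 2) (Fin 2) (w.1.adicCompletion L)} {x₀ x₁ s : w.1.adicCompletion L} {a b : v.adicCompletion ↥(maximalRealSubfield L)}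
    (hX : X * Q = Q * Matrix.diagonal ![x₀, x₁]) (hQ : IsUnit Q.det)
    (hG : Matrix.diagonal ![1, α] * X * Matrix.diagonal ![1, α⁻¹] = s • (!![a, b * v₀; b, a + b * u₀]).map (toPlace v w))
    (hcol : (Matrix.diagonal ![1, α] * Q) 0 0 = -(galAdicCompletionMap (L := L) (IsCMField.complexConj L) hw τ) * (Matrix.diagonal ![1, α] * Q) 1 0)
    (h10 : (Matrix.diagonal ![1, α] * Q) 1 0 ≠ 0)
    (h1 : Valued.v x₁ = 1) (hne : x₀ ≠ x₁)
    (hsmall₁ : Valued.v (x₀ - x₁) * Valued.v (galAdicCompletionMap (L := L) (IsCMField.complexConj L) hw τ) <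
      Valued.v (τ - galAdicCompletionMap (L := L) (IsCMField.complexConj L) hw τ))
    (hsmall₂ : Valued.v (x₀ - x₁) * Valued.v (toPlace v w u₀) <
      Valued.v (8 : w.1.adicCompletion L) * Valued.v (τ - galAdicCompletionMap (L := L) (IsCMField.complexConj L) hw τ))
    {bc : (v.adicCompletion ↥(maximalRealSubfield L))ˣ}
    (hbc : toPlace v w (bc : v.adicCompletion ↥(maximalRealSubfield L)) = (x₀ / x₁ - x₁ / x₀) / η)
    {βF : v.adicCompletion ↥(maximalRealSubfield L)} (hβF : toPlace v w βF = α * X 1 0 / X 0 0)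
    {c' : v.adicCompletion ↥(maximalRealSubfield L)} (hc' : toPlace v w c' = (τ - galAdicCompletionMap (L := L) (IsCMField.complexConj L) hw τ) / η) :
    βF = b / a ∧ βF ≠ 0 ∧
      Valued.v (toPlace v w (bc : v.adicCompletion ↥(maximalRealSubfield L))) = Valued.v (toPlace v w βF) * Valued.v (toPlace v w (2 * c')) ∧
      hilbertSymbol (v.adicCompletion ↥(maximalRealSubfield L)) ((bc : v.adicCompletion ↥(maximalRealSubfield L)) * (2 * c'))
          (algebraMap ↥(maximalRealSubfield L) _ ((cmQuadraticGenerator L : 𝓞 ↥(maximalRealSubfield L)) : ↥(maximalRealSubfield L))) =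
        hilbertSymbol (v.adicCompletion ↥(maximalRealSubfield L)) βF
          (algebraMap ↥(maximalRealSubfield L) _ ((cmQuadraticGenerator L : 𝓞 ↥(maximalRealSubfield L)) : ↥(maximalRealSubfield L))) := by
  haveI : CharZero (w.1.adicCompletion L) := charZero_of_injective_algebraMap (algebraMap L (w.1.adicCompletion L)).injective
  set σ := galAdicCompletionMap (L := L) (IsCMField.complexConj L) hw with hσdef
  set ι := toPlace v w with hιdef
  -- `(τ, στ)` is an Eisenstein pair for ★ `eigen_labels_of_descent_frame`
  have hprod' : τ * σ τ = -ι v₀ := hprod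
  -- the frame and the descent: labelled eigenvalues
  have hDD : Matrix.diagonal ![(1 : w.1.adicCompletion L), α⁻¹] * Matrix.diagonal ![1, α] = 1 := by
    rw [Matrix.diagonal_mul_diagonal, ← Matrix.diagonal_one]
    congr 1
    ext i; fin_cases i <;> simp [inv_mul_cancel₀ hα0]
  obtain ⟨hx₀, hx₁⟩ := eigen_labels_of_descent_frame ι hsum hprod' (X := X) (Q := Q) (D := Matrix.diagonal ![1, α]) (D' := Matrix.diagonal ![1, α⁻¹])
    hX hDD hG hcol h10 hQ
  -- deepness: `a ≠ 0`, `|ι β στ| < 1`, `|s ι a| = 1`, `|ι β|·|τ − στ| = |x₀ − x₁|`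
  obtain ⟨ha, hβτ', hsa, hβval⟩ := deep_bounds_of_valued_sub_lt L v w hx₀ hx₁ h1 hsmall₁
  have hιa : ι a ≠ 0 := (map_ne_zero ι).2 ha
  have hsa0 : s * ι a ≠ 0 := fun h => by rw [h, map_zero] at hsa; exact zero_ne_one hsa
  have hs : s ≠ 0 := fun h => hsa0 (by rw [h, zero_mul])
  -- the window coordinate
  have hβ : βF = b / a := windowCoord_eq_div ι hs hG hβF
  -- the Eisenstein form of the labelled eigenvalues: `x₀ = (s ι a)(1 + ι β τ)`, `x₁ = (s ι a)(1 + ι β στ)`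
  have hx₀' : x₀ = (s * ι a) * (1 + ι βF * τ) := by rw [hx₀, hβ, map_div₀]; field_simp
  have hx₁' : x₁ = (s * ι a) * (1 + ι βF * σ τ) := by rw [hx₁, hβ, map_div₀]; field_simp
  -- `β ≠ 0` (else `x₀ = x₁`)
  have hβ0 : βF ≠ 0 := by
    intro h0
    apply hne
    rw [hx₀', hx₁', h0, map_zero, zero_mul, zero_mul]
  -- the ultrametric bounds for FILE A
  have hττ : Valued.v τ = Valued.v (σ τ) := by rw [hσdef, valued_galAdicCompletionMap]
  have hβτ'' : Valued.v (ι βF * σ τ) < 1 := by rw [hβ]; exact hβτ'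
  obtain ⟨hβτ, hβu⟩ := valued_mul_lt_one_of_conj L v w hβτ'' hττ hsum
  -- `|ι β · ι u₀| < |2|` and `|ι(2 β u₀)| < |16|` from `hsmall₂`
  have hτne0 : τ - σ τ ≠ 0 := sub_ne_zero.2 hτne
  have hvτ : 0 < Valued.v (τ - σ τ) := (Valuation.pos_iff _).2 hτne0
  have hβval' : Valued.v (ι βF) * Valued.v (τ - σ τ) = Valued.v (x₀ - x₁) := by rw [hβ]; exact hβval
  have hβu8 : Valued.v (ι βF * ι u₀) < Valued.v (8 : w.1.adicCompletion L) := by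
    have hvτ0 : Valued.v (τ - σ τ) ≠ 0 := ne_of_gt hvτ
    have hβeq : Valued.v (ι βF) = Valued.v (x₀ - x₁) * (Valued.v (τ - σ τ))⁻¹ := (eq_mul_inv_iff_mul_eq₀ hvτ0).2 hβval'
    have h := mul_inv_lt_of_lt_mul₀ hsmall₂
    rw [mul_right_comm] at h
    rwa [Valuation.map_mul, hβeq]
  have h8le2 : Valued.v (8 : w.1.adicCompletion L) ≤ Valued.v (2 : w.1.adicCompletion L) := by
    have h4 : Valued.v (4 : w.1.adicCompletion L) ≤ 1 := by
      have e4 : ((4 : w.1.adicCompletionIntegers L) : w.1.adicCompletion L) = 4 := by norm_cast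
      rw [← e4]; exact (4 : w.1.adicCompletionIntegers L).2
    rw [show (8 : w.1.adicCompletion L) = 2 * 4 by norm_num, Valuation.map_mul]
    exact mul_le_of_le_one_right' h4
  have hβu2 : Valued.v (ι βF * (τ + σ τ)) < Valued.v (2 : w.1.adicCompletion L) := by
    rw [hsum]; exact lt_of_lt_of_le hβu8 h8le2
  have hdeep16 : Valued.v (ι (2 * βF * u₀)) < Valued.v ((4 : w.1.adicCompletion L) * 4) := by
    have h2v : Valued.v (2 : w.1.adicCompletion L) ≠ 0 := (Valuation.ne_zero_iff _).2 two_ne_zero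
    rw [show ι (2 * βF * u₀) = (ι βF * ι u₀) * 2 by rw [map_mul, map_mul, map_ofNat]; ring, Valuation.map_mul (Valued.v) (ι βF * ι u₀),
      show (4 : w.1.adicCompletion L) * 4 = 8 * 2 by norm_num, Valuation.map_mul (Valued.v) (8 : w.1.adicCompletion L)]
    exact mul_lt_mul_of_pos_right hβu8 (zero_lt_iff.2 h2v)
  -- DEPTH (FILE A)
  have hdepth := valued_toPlace_bcoord_eq_eisenstein L v w hsa0 hx₀' hx₁' hbc hβτ hβτ'' hβu2
  have h2c : (2 : w.1.adicCompletion L) * (τ - σ τ) / η = ι (2 * c') := by rw [map_mul, map_ofNat, hc', mul_div_assoc]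
  -- SIGN (FILE A)
  have hγ : 1 + ι βF * τ ≠ 0 := fun h0 => by
    have := valued_one_add_eq_one L v w hβτ
    rw [h0, map_zero] at this; exact zero_ne_one this
  have hγ' : 1 + ι βF * σ τ ≠ 0 := fun h0 => by
    have := valued_one_add_eq_one L v w hβτ''
    rw [h0, map_zero] at this; exact zero_ne_one this
  have hc0 : c' ≠ 0 := by
    intro h0
    rw [h0, map_zero, eq_comm, div_eq_zero_iff] at hc'
    exact hc'.elim hτne0 hη0
  have hbc' : ι (bc : v.adicCompletion ↥(maximalRealSubfield L)) =
      ι βF * (τ - σ τ) * (2 + ι βF * ι u₀) / ((1 + ι βF * τ) * (1 + ι βF * σ τ) * η) := by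
    rw [toPlace_bcoord_eq_eisenstein L v w hsa0 hγ hγ' hx₀' hx₁' hbc, hsum]
  have hsign := hilbertSymbol_bcoord_mul_eq_eisenstein L v w hw hβ0 hsum hγ hc0 hc' rfl hbc' hdeep16
  exact ⟨hβ, hβ0, by rw [hdepth, h2c], hsign⟩

end Place

/-! ## §3 The fold's currency: `exp` packaging, norm powers in the sign, non-negativity -/

section Currency

variable (L : Type) [Field L] [NumberField L] [IsCMField L] (v : HeightOneSpectrum (𝓞 ↥(maximalRealSubfield L)))
  (w : PlacesOver L v) (hw : IsCMField.complexConj L • w.1 = w.1)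

include hw in
/-- **`|ι_w y|_w = exp(−2o)` when `|y|_v = exp(−o)`** at a RAMIFIED place (`e(w|v) = 2`, ★ `valued_toPlace`). [cite: LabesseLanglands1979, §2 (2.2)] -/
theorem valued_toPlace_eq_exp_of_valued_eq_exp (he : v.asIdeal.ramificationIdx' w.1.asIdeal ≠ 1) {y : v.adicCompletion ↥(maximalRealSubfield L)} {o : ℤ}
    (hy : Valued.v y = WithZero.exp (-o)) : Valued.v (toPlace v w y) = WithZero.exp (-(2 * o)) := by
  have hc1 : IsCMField.complexConj L ≠ 1 := IsCMField.complexConj_ne_one L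
  have he2 : v.asIdeal.ramificationIdx' w.1.asIdeal = 2 := Liu2021.LemD1IndexedNonVacuityRamifiedPlace.ramificationIdx'_eq_two_of_ne_one L v (IsCMField.complexConj L) hc1 w hw he
  rw [valued_toPlace, he2, hy, ← WithZero.exp_nsmul]
  congr 1
  ring

include hw in
/-- **THE CONSTANT `k₁`**: for `c ≠ 0` in `L⁺_v`, `|ι_w c|_w = exp(−2·k₁)` with `k₁ := −log|c|_v`. [cite: LabesseLanglands1979, §2 (2.2)] -/
theorem valued_toPlace_eq_exp_neg_two_mul_neg_log (he : v.asIdeal.ramificationIdx' w.1.asIdeal ≠ 1) {c : v.adicCompletion ↥(maximalRealSubfield L)} (hc : c ≠ 0) :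
    Valued.v (toPlace v w c) = WithZero.exp (-(2 * -WithZero.log (Valued.v c))) := by
  refine valued_toPlace_eq_exp_of_valued_eq_exp L v w hw he ?_
  rw [neg_neg, WithZero.exp_log ((Valuation.ne_zero_iff _).2 hc)]

omit [IsCMField L] in
/-- **A NORM POWER DROPS FROM THE SIGN**: if `(n, d)_v = 1` (`n ≠ 0`, e.g. `n = N_{L_w∕L⁺_v}(ηE)`) then `(x·n^k, d)_v = (x, d)_v` for every `k : ℕ` and `x ≠ 0`.
[cite: Omeara1963, §63B (bimultiplicativity)] -/
theorem hilbertSymbol_mul_pow_eq_of_eq_one {x n d : v.adicCompletion ↥(maximalRealSubfield L)} (hx : x ≠ 0) (hn : n ≠ 0) (hd : d ≠ 0)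
    (h1 : hilbertSymbol (v.adicCompletion ↥(maximalRealSubfield L)) n d = 1) (k : ℕ) :
    hilbertSymbol (v.adicCompletion ↥(maximalRealSubfield L)) (x * n ^ k) d = hilbertSymbol (v.adicCompletion ↥(maximalRealSubfield L)) x d := by
  induction k with
  | zero => rw [pow_zero, mul_one]
  | succ k ih =>
    rw [pow_succ, ← mul_assoc, hilbertSymbol_adicCompletion_mul_left ↥(maximalRealSubfield L) v (mul_ne_zero hx (pow_ne_zero _ hn)) hn hd, ih, h1, mul_one]

omit [IsCMField L] in
/-- The inverse-power form: `(x·(n^k)⁻¹, d)_v = (x, d)_v` for `(n, d)_v = 1`. [cite: Omeara1963, §63B] -/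
theorem hilbertSymbol_mul_pow_inv_eq_of_eq_one {x n d : v.adicCompletion ↥(maximalRealSubfield L)} (hx : x ≠ 0) (hn : n ≠ 0) (hd : d ≠ 0)
    (h1 : hilbertSymbol (v.adicCompletion ↥(maximalRealSubfield L)) n d = 1) (k : ℕ) :
    hilbertSymbol (v.adicCompletion ↥(maximalRealSubfield L)) (x * (n ^ k)⁻¹) d = hilbertSymbol (v.adicCompletion ↥(maximalRealSubfield L)) x d := by
  rw [hilbertSymbol_adicCompletion_mul_left ↥(maximalRealSubfield L) v hx (inv_ne_zero (pow_ne_zero _ hn)) hd, hilbertSymbol_inv_left (pow_ne_zero _ hn),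
    ← hilbertSymbol_adicCompletion_mul_left ↥(maximalRealSubfield L) v hx (pow_ne_zero _ hn) hd, hilbertSymbol_mul_pow_eq_of_eq_one L v hx hn hd h1 k]

omit [IsCMField L] in
/-- The `zpow` form: `(x·n^k, d)_v = (x, d)_v` for `(n, d)_v = 1`, `k : ℤ`. [cite: Omeara1963, §63B] -/
theorem hilbertSymbol_mul_zpow_eq_of_eq_one {x n d : v.adicCompletion ↥(maximalRealSubfield L)} (hx : x ≠ 0) (hn : n ≠ 0) (hd : d ≠ 0)
    (h1 : hilbertSymbol (v.adicCompletion ↥(maximalRealSubfield L)) n d = 1) (k : ℤ) :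
    hilbertSymbol (v.adicCompletion ↥(maximalRealSubfield L)) (x * n ^ k) d = hilbertSymbol (v.adicCompletion ↥(maximalRealSubfield L)) x d := by
  cases k with
  | ofNat k => rw [Int.ofNat_eq_natCast, zpow_natCast]; exact hilbertSymbol_mul_pow_eq_of_eq_one L v hx hn hd h1 k
  | negSucc k => rw [zpow_negSucc]; exact hilbertSymbol_mul_pow_inv_eq_of_eq_one L v hx hn hd h1 (k + 1)

include hw in
/-- **PACKAGING `hoT`**: from the place-level dictionary `|ι bc| = |ι βF|·|ι(2c′)|`, `|βF|_v = exp(−o)` and `k₁ := −log|2c′|_v`:  `|ι bc|_w = exp(−(2o + 2k₁))`.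
[cite: LabesseLanglands1979, §2 (2.2)] [cite: Labesse2024StabilisationGermesSL2, Th. 0.0.12] -/
theorem valued_toPlace_bcoord_eq_exp (he : v.asIdeal.ramificationIdx' w.1.asIdeal ≠ 1) {bc βF c : v.adicCompletion ↥(maximalRealSubfield L)} (hc : c ≠ 0) {o : ℕ}
    (hdict : Valued.v (toPlace v w bc) = Valued.v (toPlace v w βF) * Valued.v (toPlace v w c)) (hβ : Valued.v βF = WithZero.exp (-(o : ℤ))) :
    Valued.v (toPlace v w bc) = WithZero.exp (-(2 * (o : ℤ) + 2 * -WithZero.log (Valued.v c))) := by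
  rw [hdict, valued_toPlace_eq_exp_of_valued_eq_exp L v w hw he hβ, valued_toPlace_eq_exp_neg_two_mul_neg_log L v w hw he hc, ← WithZero.exp_add]
  congr 1
  ring

omit [IsCMField L] in
/-- **PACKAGING `hnn`**: `|ι bc|_w = exp(−(2o + 2k₁))` and `|ι bc|_w ≤ 1` give `0 ≤ o + k₁`. [cite: LabesseLanglands1979, §2 (2.2)] -/
theorem add_nonneg_of_valued_toPlace_eq_exp_le_one {bc : v.adicCompletion ↥(maximalRealSubfield L)} {o k₁ : ℤ}
    (h : Valued.v (toPlace v w bc) = WithZero.exp (-(2 * o + 2 * k₁))) (hle : Valued.v (toPlace v w bc) ≤ 1) : 0 ≤ o + k₁ := by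
  rw [h, ← WithZero.exp_zero, WithZero.exp_le_exp] at hle
  omega

end Currency

end Literature.NumberTheory.Rogawski1990

end
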